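import Mathlib.Topology.Algebra.Order.Floor
import Literature.Topology.FourManifolds.CircleLoops
import Summits.SmoothPoincare4.SmoothPoincare4.Theses.DottedCircleRasmussen

/-!
# Helper `helper_friendsCarrier_Vk_partA_loopDescent` (piece 10 of the registered stub
`helper_friendsCarrier_Vk_partA`, line `mk_friends`, skeleton v8) for crux `DcrGap`
(item stmt-SmoothPoincare4-16128, route route-SmoothPoincare4-DottedCircleRasmussen)

**A null-homotopy of a loop parametrised by `[0, 1]` descends to a null-homotopy of the map on the
circle.**  The homological argument for the push-off input of Part A produces, for the fibre-coordinate
loop `t ↦ f(e^{2πit})` read on `[0, 1]`, a homotopy `h : [0,1] × [0,1] → ℝ² ∖ 0` to a constant through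
LOOPS (`h(s, 0) = h(s, 1)`); the push-off input wants a homotopy `[0,1] × 𝕊¹ → ℝ² ∖ 0` of `f` itself.  This
file descends the one to the other: `h(s, fract(x/2π))` is a jointly continuous `2π`-periodic family on
the line (Mathlib's `ContinuousOn.comp_fract'`), and `circlePoint : ℝ → 𝕊¹` is an open quotient map
(`isOpenMap_circlePoint`, `CircleLoops.lean`), so the family factors continuously through `[0,1] × 𝕊¹`.

* `helper_friendsCarrier_Vk_partA_loopDescent` — the registered statement.

No definitions, no named facts, no `sorry`.

## References

* M. W. Hirsch, *Differential Topology*, GTM 33 (1976), Ch. 1 §1 (the circle as a quotient of the line).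
  [Hirsch1976]
-/

-- the prescribed namespace `Summit.<P>.<Sub>.…` duplicates `SmoothPoincare4` (P = Sub)
set_option linter.dupNamespace false
set_option linter.style.longLine false

noncomputable section

open scoped Topology unitInterval
open Set Function Metric Filter Literature.Topology.FourManifolds

namespace Summit.SmoothPoincare4.SmoothPoincare4.Theorems.DcrGap.MkFriends

namespace FriendsCarrierVk

/-- **Descending a null-homotopy through loops of `[0,1]` to the circle.** [cite: Hirsch1976, Ch. 1 §1] -/
theorem exists_descend_nullhomotopy {Y : Type*} [TopologicalSpace Y] (f : (sphere (0 : EuclideanSpace ℝ (Fin 2)) 1) → Y)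
    (h : I × I → Y) (hc : Continuous h) (hstart : ∀ t : I, h (0, t) = f (circlePoint (2 * Real.pi * t)))
    (hloop : ∀ s : I, h (s, 0) = h (s, 1)) (e : Y) (hend : ∀ t : I, h (1, t) = e) :
    ∃ G : I × (sphere (0 : EuclideanSpace ℝ (Fin 2)) 1) → Y, Continuous G ∧ (∀ q, G q = h (q.1, projIcc 0 1 zero_le_one (Int.fract (Classical.choose (circlePoint_surjective q.2) / (2 * Real.pi))))) ∧
      (∀ u, G (0, u) = f u) ∧ ∀ u, G (1, u) = e := by
  have h2π : 0 < 2 * Real.pi := Real.two_pi_pos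
  -- the periodic family on the line
  set P : I × ℝ → Y := fun q => h (q.1, projIcc 0 1 zero_le_one (Int.fract (q.2 / (2 * Real.pi)))) with hP
  have hPc : Continuous P := by
    have h1 : Continuous fun st : I × ℝ => h (st.1, projIcc 0 1 zero_le_one (Int.fract st.2)) := by
      refine ContinuousOn.comp_fract' (f := fun (s : I) (y : ℝ) => h (s, projIcc 0 1 zero_le_one y)) ?_ ?_
      · exact (hc.comp (continuous_fst.prodMk (continuous_projIcc.comp continuous_snd))).continuousOn
      · intro s
        simp only [projIcc_left, projIcc_right]
        exact hloop s
    have h2 : Continuous fun q : I × ℝ => ((q.1, q.2 / (2 * Real.pi)) : I × ℝ) :=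
      continuous_fst.prodMk (continuous_snd.div_const _)
    have hPeq : P = (fun st : I × ℝ => h (st.1, projIcc 0 1 zero_le_one (Int.fract st.2))) ∘ fun q : I × ℝ => ((q.1, q.2 / (2 * Real.pi)) : I × ℝ) := rfl
    rw [hPeq]; exact h1.comp h2
  have hPper : ∀ (s : I) (x : ℝ) (k : ℤ), P (s, x + k * (2 * Real.pi)) = P (s, x) := by
    intro s x k
    simp only [hP]
    congr 3
    rw [add_div, mul_div_cancel_right₀ _ h2π.ne', Int.fract_add_intCast]
  -- the angle of a point of the circle
  have hθ : ∀ u : (sphere (0 : EuclideanSpace ℝ (Fin 2)) 1), circlePoint (Classical.choose (circlePoint_surjective u)) = u :=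
    fun u => Classical.choose_spec (circlePoint_surjective u)
  set G : I × (sphere (0 : EuclideanSpace ℝ (Fin 2)) 1) → Y := fun q => P (q.1, Classical.choose (circlePoint_surjective q.2)) with hG
  have hGP : ∀ (s : I) (x : ℝ), G (s, circlePoint x) = P (s, x) := by
    intro s x
    simp only [hG]
    obtain ⟨k, hk⟩ := exists_eq_add_of_circlePoint_eq (hθ (circlePoint x))
    rw [hk, hPper]
  -- continuity through the open quotient map `(s, x) ↦ (s, e^{ix})`
  have hq : IsOpenQuotientMap (Prod.map (id : I → I) circlePoint) :=
    ⟨surjective_id.prodMap circlePoint_surjective, continuous_id.prodMap continuous_circlePoint,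
      IsOpenMap.id.prodMap isOpenMap_circlePoint⟩
  have hGc : Continuous G := by
    rw [hq.isQuotientMap.continuous_iff]
    have : G ∘ Prod.map (id : I → I) circlePoint = P := by
      funext q; exact hGP q.1 q.2
    rw [this]; exact hPc
  refine ⟨G, hGc, fun q => rfl, fun u => ?_, fun u => ?_⟩
  · obtain ⟨x, rfl⟩ := circlePoint_surjective u
    rw [hGP]
    simp only [hP, hstart]
    congr 1
    -- `e^{i · 2π fract (x / 2π)} = e^{ix}`
    have hf01 : Int.fract (x / (2 * Real.pi)) ∈ Icc (0 : ℝ) 1 := ⟨Int.fract_nonneg _, (Int.fract_lt_one _).le⟩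
    rw [projIcc_of_mem _ hf01]
    change circlePoint (2 * Real.pi * Int.fract (x / (2 * Real.pi))) = circlePoint x
    rw [Int.fract, mul_sub, mul_div_cancel₀ _ h2π.ne']
    rw [show x - 2 * Real.pi * ((⌊x / (2 * Real.pi)⌋ : ℤ) : ℝ) = x + ((-⌊x / (2 * Real.pi)⌋ : ℤ) : ℝ) * (2 * Real.pi) by push_cast; ring]
    exact periodic_circlePoint.int_mul _ x
  · obtain ⟨x, rfl⟩ := circlePoint_surjective u
    rw [hGP]
    simp only [hP, hend]

end FriendsCarrierVk

open FriendsCarrierVk in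
/-- **Helper `helper_friendsCarrier_Vk_partA_loopDescent`** (piece of `helper_friendsCarrier_Vk_partA`: descending
a null-homotopy through loops of `[0,1]` to the circle).  If `h : [0,1] × [0,1] → Y` is continuous, with
`h(0, t) = f(e^{2πit})`, `h(s, 0) = h(s, 1)` and `h(1, t) = e`, then `f : 𝕊¹ → Y` is freely homotopic to the
constant `e` through a homotopy taking only values of `h`. [cite: Hirsch1976, Ch. 1 §1] -/
theorem helper_friendsCarrier_Vk_partA_loopDescent : ∀ (Y : Type) [TopologicalSpace Y] (f : (Metric.sphere (0 : EuclideanSpace ℝ (Fin 2)) 1) → Y) (h : unitInterval × unitInterval → Y), Continuous h → (∀ t : unitInterval, h (0, t) = f (Literature.Topology.FourManifolds.circlePoint (2 * Real.pi * t))) → (∀ s : unitInterval, h (s, 0) = h (s, 1)) → ∀ e : Y, (∀ t : unitInterval, h (1, t) = e) → ∃ G : unitInterval × (Metric.sphere (0 : EuclideanSpace ℝ (Fin 2)) 1) → Y, Continuous G ∧ (∀ q, ∃ q', G q = h q') ∧ (∀ u, G (0, u) = f u) ∧ ∀ u, G (1, u) = e := by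
  intro Y _ f h hc hstart hloop e hend
  obtain ⟨G, hGc, hGh, hG0, hG1⟩ := exists_descend_nullhomotopy f h hc hstart hloop e hend
  exact ⟨G, hGc, fun q => ⟨_, hGh q⟩, hG0, hG1⟩

end Summit.SmoothPoincare4.SmoothPoincare4.Theorems.DcrGap.MkFriends

end
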